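import Literature.AlgebraicGeometry.Motives.CartierDivisorCechSection
import Literature.AlgebraicGeometry.Motives.CechComplexFieldPointBaseChange
import HarnessLib

/-!
# Čech sections of `φ^*𝒪(D)` on a Čech cover, indexed by simplices: the edge form of the cocycle condition

`Motives/CartierDivisorCechSection` describes `H⁰(X', φ^*𝒪_Y(D))` (`φ : X' → Y`, `Y` integral,
`D = (U_i, f_i)` a Cartier divisor) as families `(s_a ∈ Γ(φ⁻¹V_a, 𝒪_{X'}))_a` on a charted family of
opens `(V_a ⊆ U_{c(a)})_a` whose preimages cover `X'`, subject to `s_a = φ^*(g_{c(a)c(b)}) s_b` on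
`φ⁻¹V_a ∩ φ⁻¹V_b` for ALL pairs `(a, b)` (`ChartedCover.CechSection`, glued to the charts by
`ChartedCover.sectionAlongEquiv`). The ordered Čech complex of `𝒪_Y(D)` on a Čech cover
`𝔚 = (W_0, …, W_r)` of `pr⁻¹V` (`Motives/CartierDivisorCech`; `Literature/Algebra/Homology/OrderedCech`)
is indexed instead by simplices — vertices `σ = {a}`, edges `τ = {a < b}` with the members
`W_σ = pr⁻¹V ∩ W_a`, `W_τ = pr⁻¹V ∩ W_a ∩ W_b` — and its `Ȟ⁰` after a base change is cut out by ONE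
condition per edge, from the smaller to the larger vertex
(`Literature/Algebra/Homology/OrderedCechBaseChange`, `OrderedCech.compatibleFamilies`; on the
geometric side `FieldPointBaseChange.compatible` of `Motives/CechComplexFieldPointBaseChange`). This
file bridges the two shapes, for an arbitrary morphism `φ : X' → Y` factoring through `pr⁻¹V`:

* `CechCover.simplexCover 𝔚` — the charted family `σ ↦ W_σ ⊆ U_{c(σ)}`, `c(σ) = c(min σ)`
  (`CechCover.chartOf`), indexed by the `0`-simplices; its preimages cover `X'`
  (`top_le_iSup_preimage_simplexCover`);
* `CechCover.EdgeCompatible 𝔚 φ h` — for a family `h_σ ∈ Γ(φ⁻¹W_σ, 𝒪_{X'})`: for every edge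
  `τ = {a < b}`, `h_a|_{φ⁻¹W_τ} = h_b|_{φ⁻¹W_τ} · φ^*(u_τ)` with `u_τ = f_{c(a)}/f_{c(b)}|_{W_τ}`
  (`CechCover.unitSection`), and the additive group `CechCover.edgeCompatible 𝔚 φ` of such families;
* `CechCover.cechSectionEquivEdgeCompatible` — **the two shapes agree**: a `CechSection` of
  `simplexCover 𝔚` along `φ` is the same as an edge-compatible family (the all-pairs cocycle
  condition follows from the edge conditions: it is symmetric — the cocycle is a unit with
  `g_{ij} g_{ji} = 1` — and trivial on the diagonal), an isomorphism of additive groups which is the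
  identity on coordinates.

Pure bookkeeping (sheaf restrictions and the cocycle identities of
`Motives/CartierDivisorCechTrivialization`); everything is proved. It is the combinatorial half of the
identification `H⁰(X', φ^*𝒪_Y(D)) ≅ Ker(d⁰_Č ⊗ B)` for affine base changes (Görtz–Wedhorn II,
(23.28.5) / Cor. 23.137 in degree `0`; Mumford, *Abelian Varieties*, §5), assembled in a sibling file.

## References

* U. Görtz, T. Wedhorn, *Algebraic Geometry II: Cohomology of Schemes*, Springer Spektrum (2023),
  doi:10.1007/978-3-658-43031-3: Lemma 21.65, p. 259; Def. 21.68, p. 260; (23.28.5), p. 482.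
  [GortzWedhorn2023]
* U. Görtz, T. Wedhorn, *Algebraic Geometry I: Schemes*, 2nd ed. (2020): (11.9), p. 374; Rem. 11.16,
  p. 369. [GortzWedhorn2020]
* D. Mumford, *Abelian Varieties*, TIFR Studies in Mathematics 5 (1970), §5. [MumfordAV1970]
-/

universe u

open CategoryTheory AlgebraicGeometry TopologicalSpace Opposite
open Literature.Algebra.Homology Literature.Algebra.Homology.OrderedCech

noncomputable section

namespace Literature.AlgebraicGeometry.Motives

namespace CartierDivisor

open RatFn

/-! ### Transport lemmas for the pulled-back cocycle -/

section PullTrans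

variable {X X' : Scheme.{u}} [IsIntegral X] (D : CartierDivisor X) (φ : X' ⟶ X)

/-- `φ^*(g_{ij})` only depends on the charts `i`, `j` (transport along equalities of indices).
[folklore] -/
theorem pullTrans_congr {i i' j j' : D.ι} (hi : i = i') (hj : j = j') (W : X'.Opens)
    (h : W ≤ φ ⁻¹ᵁ (D.U i ⊓ D.U j)) (h' : W ≤ φ ⁻¹ᵁ (D.U i' ⊓ D.U j')) :
    D.pullTrans φ i j W h = D.pullTrans φ i' j' W h' := by
  subst hi; subst hj; rfl

/-- `φ^*(g_{ij}) = 1` when `i = j`. [folklore] -/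
theorem pullTrans_eq_one_of_eq {i j : D.ι} (hij : i = j) (W : X'.Opens)
    (h : W ≤ φ ⁻¹ᵁ (D.U i ⊓ D.U j)) : D.pullTrans φ i j W h = 1 := by
  subst hij; exact D.pullTrans_self φ i W h

end PullTrans

namespace CechCover

variable {Y B : Scheme.{u}} [IsIntegral Y] {pr : Y ⟶ B} {V : B.Opens} {D : CartierDivisor Y}
  (𝔚 : CechCover pr V D)

/-! ### The charted family of the simplices of a Čech cover -/

/-- **The members `W_σ` of a Čech cover indexed by its `0`-simplices, as a charted family**:
`σ ↦ W_σ = pr⁻¹V ∩ ⋂_{a ∈ σ} W_a ⊆ U_{c(σ)}` with the chart `c(σ) = c(min σ)` (`CechCover.chartOf`);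
the index type is lifted to the universe of schemes (`ULift`). Reducible, so that its fields
compute. [folklore] -/
@[reducible] def simplexCover : D.ChartedCover where
  κ := ULift.{u} (Simplex (Fin (𝔚.r + 1)) 0)
  V σ := 𝔚.opens σ.down.1
  chart σ := 𝔚.chartOf σ.down.1 σ.down.2.1
  V_le σ := 𝔚.opens_le_U_chartOf σ.down.1 σ.down.2.1

/-- A point of `W_a` over `V` lies in the member `W_{{a}}` of the vertex `{a}`. [folklore] -/
theorem mem_opens_vertex {y : Y} (hy : y ∈ pr ⁻¹ᵁ V) {a : Fin (𝔚.r + 1)} (ha : y ∈ 𝔚.W a) :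
    y ∈ 𝔚.opens (vertex a).1 :=
  𝔚.mem_opens_iff.2 ⟨hy, fun b hb => by
    rw [vertex_val, Finset.mem_singleton] at hb
    subst hb
    exact ha⟩

/-- **The preimages of the `W_σ` cover `X'`** for any `φ : X' → Y` factoring through `pr⁻¹V` (the
`W_a` cover `pr⁻¹V`, and `W_{{a}} = pr⁻¹V ∩ W_a`). [folklore] -/
theorem top_le_iSup_preimage_simplexCover {X' : Scheme.{u}} (φ : X' ⟶ Y)
    (hφ : ∀ x, φ x ∈ pr ⁻¹ᵁ V) :
    (⊤ : X'.Opens) ≤ ⨆ σ : 𝔚.simplexCover.κ, φ ⁻¹ᵁ 𝔚.simplexCover.V σ := by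
  intro x _
  have hx : φ x ∈ (⨆ a, 𝔚.W a : Y.Opens) := by
    rw [𝔚.iSup_W]; exact hφ x
  obtain ⟨a, ha⟩ := Opens.mem_iSup.1 hx
  exact Opens.mem_iSup.2 ⟨ULift.up (vertex a), 𝔚.mem_opens_vertex (hφ x) ha⟩

/-- **`W_{min τ} ∩ W_{max τ} ⊆ W_τ`** for an edge `τ` (equality in fact: `τ = {min τ, max τ}`).
[folklore] -/
theorem opens_src_inf_opens_tgt_le (τ : Simplex (Fin (𝔚.r + 1)) 1) :
    𝔚.opens (src τ).1 ⊓ 𝔚.opens (tgt τ).1 ≤ 𝔚.opens τ.1 := by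
  obtain ⟨a, c, hac, rfl⟩ := exists_eq_edge τ
  rw [src_edge, tgt_edge]
  intro y hy
  have ha := 𝔚.mem_opens_iff.1 hy.1
  have hc := 𝔚.mem_opens_iff.1 hy.2
  refine 𝔚.mem_opens_iff.2 ⟨ha.1, fun b hb => ?_⟩
  rw [edge_val, Finset.mem_insert, Finset.mem_singleton] at hb
  rcases hb with rfl | rfl
  · exact ha.2 b (by rw [vertex_val]; exact Finset.mem_singleton_self b)
  · exact hc.2 b (by rw [vertex_val]; exact Finset.mem_singleton_self b)

/-- **The pulled-back edge cocycle**: `φ^*(u_τ)|_W = φ^*(g_{c(τ) c(max τ)})|_W`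
(`CechCover.unitSection`, `CartierDivisor.pullTrans`). [folklore] -/
theorem appLE_unitSection {X' : Scheme.{u}} (φ : X' ⟶ Y) (τ : Simplex (Fin (𝔚.r + 1)) 1)
    {W : X'.Opens} (hW : W ≤ φ ⁻¹ᵁ 𝔚.opens τ.1) :
    φ.appLE (𝔚.opens τ.1) W hW (𝔚.unitSection τ) =
      D.pullTrans φ (𝔚.chartOf τ.1 τ.2.1) (𝔚.chartOf (tgt τ).1 (tgt τ).2.1) W
        (hW.trans (φ.preimage_mono (𝔚.opens_le_U_inf_U τ))) := by
  rw [CechCover.unitSection, ← CommRingCat.comp_apply, Scheme.Hom.map_appLE]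
  rfl

/-! ### Edge-compatible families -/

/-- **Edge-compatible families**: `(h_σ ∈ Γ(φ⁻¹W_σ, 𝒪_{X'}))_σ` over the `0`-simplices with, for every
edge `τ`, `h_{min τ}|_{φ⁻¹W_τ} = h_{max τ}|_{φ⁻¹W_τ} · φ^*(u_τ)` — the `Ȟ⁰`-condition of the ordered Čech
complex of `φ^*𝒪_Y(D)` on `(φ⁻¹W_a)_a` in the trivialisations `φ^*(f_{c(a)}⁻¹)` (Görtz–Wedhorn II,
Lemma 21.65 / Def. 21.68). [cite: GortzWedhorn2023, Def. 21.68 (p. 260)] -/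
def EdgeCompatible {X' : Scheme.{u}} (φ : X' ⟶ Y)
    (h : ∀ σ : Simplex (Fin (𝔚.r + 1)) 0, Γ(X', φ ⁻¹ᵁ 𝔚.opens σ.1)) : Prop :=
  ∀ τ : Simplex (Fin (𝔚.r + 1)) 1,
    X'.presheaf.map (homOfLE (φ.preimage_mono (𝔚.opens_le_opens_src τ))).op (h (src τ)) =
      X'.presheaf.map (homOfLE (φ.preimage_mono (𝔚.opens_le_opens_tgt τ))).op (h (tgt τ)) *
        φ.appLE (𝔚.opens τ.1) (φ ⁻¹ᵁ 𝔚.opens τ.1) le_rfl (𝔚.unitSection τ)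

/-- **The additive group of edge-compatible families** (the condition is linear). [folklore] -/
def edgeCompatible {X' : Scheme.{u}} (φ : X' ⟶ Y) :
    AddSubgroup (∀ σ : Simplex (Fin (𝔚.r + 1)) 0, Γ(X', φ ⁻¹ᵁ 𝔚.opens σ.1)) where
  carrier := {h | 𝔚.EdgeCompatible φ h}
  zero_mem' τ := by simp only [Pi.zero_apply, map_zero, zero_mul]
  add_mem' {h h'} hh hh' τ := by
    simp only [Pi.add_apply, map_add, add_mul]
    rw [hh τ, hh' τ]
  neg_mem' {h} hh τ := by
    simp only [Pi.neg_apply, map_neg, neg_mul]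
    rw [hh τ]

/-- Membership in `edgeCompatible`. [folklore] -/
@[simp] theorem mem_edgeCompatible_iff {X' : Scheme.{u}} (φ : X' ⟶ Y)
    {h : ∀ σ : Simplex (Fin (𝔚.r + 1)) 0, Γ(X', φ ⁻¹ᵁ 𝔚.opens σ.1)} :
    h ∈ 𝔚.edgeCompatible φ ↔ 𝔚.EdgeCompatible φ h := Iff.rfl

/-! ### From Čech sections to edge-compatible families -/

section Bridge

variable {𝔚} {X' : Scheme.{u}} {φ : X' ⟶ Y}

/-- `φ⁻¹W_{min τ} ∩ φ⁻¹W_{max τ} ⊆ φ⁻¹W_τ` (`opens_src_inf_opens_tgt_le`). [folklore] -/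
theorem preimage_src_inf_tgt_le (τ : Simplex (Fin (𝔚.r + 1)) 1) :
    φ ⁻¹ᵁ 𝔚.opens (src τ).1 ⊓ φ ⁻¹ᵁ 𝔚.opens (tgt τ).1 ≤ φ ⁻¹ᵁ 𝔚.opens τ.1 :=
  fun _ hx => 𝔚.opens_src_inf_opens_tgt_le τ ⟨hx.1, hx.2⟩

/-- **The edge cocycle is the restriction of the charted cocycle**: on any `W ⊆ φ⁻¹W_τ`,
`φ^*(u_τ)|_W = φ^*(g_{c(min τ) c(max τ)})|_W` (the chart of `τ` is that of `min τ`). [folklore] -/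
theorem appLE_unitSection_eq_trans (τ : Simplex (Fin (𝔚.r + 1)) 1) {W : X'.Opens}
    (hW : W ≤ φ ⁻¹ᵁ 𝔚.opens τ.1)
    (h : W ≤ φ ⁻¹ᵁ 𝔚.simplexCover.V (ULift.up (src τ)) ⊓ φ ⁻¹ᵁ 𝔚.simplexCover.V (ULift.up (tgt τ))) :
    φ.appLE (𝔚.opens τ.1) W hW (𝔚.unitSection τ) =
      X'.presheaf.map (homOfLE h).op (𝔚.simplexCover.trans φ (ULift.up (src τ)) (ULift.up (tgt τ))) := by
  rw [𝔚.simplexCover.map_trans φ (ULift.up (src τ)) (ULift.up (tgt τ)) h, appLE_unitSection]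
  exact D.pullTrans_congr φ (𝔚.chartOf_src τ).symm rfl W _ _

/-- **A Čech section is edge-compatible** (its cocycle condition between `min τ` and `max τ`,
restricted to `φ⁻¹W_τ`). [folklore] -/
theorem edgeCompatible_of_cechSection (t : 𝔚.simplexCover.CechSection φ) :
    𝔚.EdgeCompatible φ fun σ => t.s (ULift.up σ) := by
  intro τ
  have hs : φ ⁻¹ᵁ 𝔚.opens τ.1 ≤ φ ⁻¹ᵁ 𝔚.simplexCover.V (ULift.up (src τ)) :=
    φ.preimage_mono (𝔚.opens_le_opens_src τ)
  have ht : φ ⁻¹ᵁ 𝔚.opens τ.1 ≤ φ ⁻¹ᵁ 𝔚.simplexCover.V (ULift.up (tgt τ)) :=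
    φ.preimage_mono (𝔚.opens_le_opens_tgt τ)
  have h := t.cocycle_res (ULift.up (src τ)) (ULift.up (tgt τ)) hs ht
  rw [appLE_unitSection_eq_trans τ le_rfl (le_inf hs ht)]
  exact h.trans (mul_comm _ _)

variable (𝔚) in
/-- The map to edge-compatible families, `t ↦ (t_σ)_σ`. [folklore] -/
def toEdgeCompatible (t : 𝔚.simplexCover.CechSection φ) : 𝔚.edgeCompatible φ :=
  ⟨fun σ => t.s (ULift.up σ), edgeCompatible_of_cechSection t⟩

/-! ### From edge-compatible families to Čech sections -/

/-- The all-pairs cocycle between the END POINTS of an edge, from its edge condition. [folklore] -/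
theorem EdgeCompatible.cocycle_src_tgt {h : ∀ σ : Simplex (Fin (𝔚.r + 1)) 0, Γ(X', φ ⁻¹ᵁ 𝔚.opens σ.1)}
    (hh : 𝔚.EdgeCompatible φ h) (τ : Simplex (Fin (𝔚.r + 1)) 1) (a b : 𝔚.simplexCover.κ)
    (ea : a = ULift.up (src τ)) (eb : b = ULift.up (tgt τ)) :
    X'.presheaf.map (homOfLE (inf_le_left : φ ⁻¹ᵁ 𝔚.simplexCover.V a ⊓ φ ⁻¹ᵁ 𝔚.simplexCover.V b ≤ _)).op
        (h a.down) =
      𝔚.simplexCover.trans φ a b *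
        X'.presheaf.map (homOfLE (inf_le_right : φ ⁻¹ᵁ 𝔚.simplexCover.V a ⊓ φ ⁻¹ᵁ 𝔚.simplexCover.V b ≤ _)).op
          (h b.down) := by
  subst ea; subst eb
  have hle := preimage_src_inf_tgt_le (𝔚 := 𝔚) (φ := φ) τ
  have key := congrArg (X'.presheaf.map (homOfLE hle).op) (hh τ)
  rw [map_mul, res_res, res_res, ← CommRingCat.comp_apply (φ.appLE _ _ le_rfl),
    Scheme.Hom.appLE_map, appLE_unitSection_eq_trans τ hle le_rfl, map_homOfLE_refl,
    mul_comm] at key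
  exact key

/-- The all-pairs cocycle between the end points of an edge, in the REVERSE order. [folklore] -/
theorem EdgeCompatible.cocycle_tgt_src {h : ∀ σ : Simplex (Fin (𝔚.r + 1)) 0, Γ(X', φ ⁻¹ᵁ 𝔚.opens σ.1)}
    (hh : 𝔚.EdgeCompatible φ h) (τ : Simplex (Fin (𝔚.r + 1)) 1) (a b : 𝔚.simplexCover.κ)
    (ea : a = ULift.up (tgt τ)) (eb : b = ULift.up (src τ)) :
    X'.presheaf.map (homOfLE (inf_le_left : φ ⁻¹ᵁ 𝔚.simplexCover.V a ⊓ φ ⁻¹ᵁ 𝔚.simplexCover.V b ≤ _)).op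
        (h a.down) =
      𝔚.simplexCover.trans φ a b *
        X'.presheaf.map (homOfLE (inf_le_right : φ ⁻¹ᵁ 𝔚.simplexCover.V a ⊓ φ ⁻¹ᵁ 𝔚.simplexCover.V b ≤ _)).op
          (h b.down) := by
  subst ea; subst eb
  set A := ULift.up.{u} (src τ) with hA
  set C := ULift.up.{u} (tgt τ) with hC
  -- the cocycle in the direct order, on `W = φ⁻¹W_{max τ} ∩ φ⁻¹W_{min τ}`
  have hba := hh.cocycle_src_tgt τ A C rfl rfl
  have e := congrArg (X'.presheaf.map (homOfLE (le_inf inf_le_right inf_le_left :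
    φ ⁻¹ᵁ 𝔚.simplexCover.V C ⊓ φ ⁻¹ᵁ 𝔚.simplexCover.V A ≤
      φ ⁻¹ᵁ 𝔚.simplexCover.V A ⊓ φ ⁻¹ᵁ 𝔚.simplexCover.V C)).op) hba
  rw [map_mul, res_res, res_res] at e
  -- multiply by the inverse cocycle
  have hinv := 𝔚.simplexCover.trans_mul_trans_symm φ C A
    (W := φ ⁻¹ᵁ 𝔚.simplexCover.V C ⊓ φ ⁻¹ᵁ 𝔚.simplexCover.V A) inf_le_left inf_le_right
  rw [map_homOfLE_refl] at hinv
  calc X'.presheaf.map (homOfLE inf_le_left).op (h C.down)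
      = (𝔚.simplexCover.trans φ C A *
          X'.presheaf.map (homOfLE (le_inf inf_le_right inf_le_left)).op
            (𝔚.simplexCover.trans φ A C)) *
          X'.presheaf.map (homOfLE inf_le_left).op (h C.down) := by rw [hinv, one_mul]
    _ = 𝔚.simplexCover.trans φ C A *
          (X'.presheaf.map (homOfLE (le_inf inf_le_right inf_le_left)).op
              (𝔚.simplexCover.trans φ A C) *
            X'.presheaf.map (homOfLE inf_le_left).op (h C.down)) := by rw [mul_assoc]
    _ = 𝔚.simplexCover.trans φ C A *
          X'.presheaf.map (homOfLE inf_le_right).op (h A.down) := by rw [← e]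

/-- **An edge-compatible family satisfies the all-pairs cocycle condition**: between two vertices
`{i}`, `{j}` it is trivial for `i = j`, the edge condition for `i < j`, and its inverse for `j < i`.
[folklore] -/
theorem EdgeCompatible.cocycle {h : ∀ σ : Simplex (Fin (𝔚.r + 1)) 0, Γ(X', φ ⁻¹ᵁ 𝔚.opens σ.1)}
    (hh : 𝔚.EdgeCompatible φ h) (a b : 𝔚.simplexCover.κ) :
    X'.presheaf.map (homOfLE (inf_le_left : φ ⁻¹ᵁ 𝔚.simplexCover.V a ⊓ φ ⁻¹ᵁ 𝔚.simplexCover.V b ≤ _)).op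
        (h a.down) =
      𝔚.simplexCover.trans φ a b *
        X'.presheaf.map (homOfLE (inf_le_right : φ ⁻¹ᵁ 𝔚.simplexCover.V a ⊓ φ ⁻¹ᵁ 𝔚.simplexCover.V b ≤ _)).op
          (h b.down) := by
  obtain ⟨a⟩ := a
  obtain ⟨b⟩ := b
  obtain ⟨i, rfl⟩ := exists_eq_vertex a
  obtain ⟨j, rfl⟩ := exists_eq_vertex b
  rcases lt_trichotomy i j with hij | rfl | hji
  · exact hh.cocycle_src_tgt (edge i j hij) _ _ (congrArg ULift.up (src_edge i j hij).symm)
      (congrArg ULift.up (tgt_edge i j hij).symm)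
  · rw [𝔚.simplexCover.trans_eq_one_of_chart_eq φ rfl, one_mul]
  · exact hh.cocycle_tgt_src (edge j i hji) _ _ (congrArg ULift.up (tgt_edge j i hji).symm)
      (congrArg ULift.up (src_edge j i hji).symm)

variable (𝔚) in
/-- **The Čech section defined by an edge-compatible family.** [folklore] -/
def ofEdgeCompatible (h : 𝔚.edgeCompatible φ) : 𝔚.simplexCover.CechSection φ where
  s σ := h.1 σ.down
  cocycle a b := EdgeCompatible.cocycle h.2 a b

variable (𝔚) (φ) in
/-- **Čech sections on the simplices of `𝔚` = edge-compatible families**, as additive groups, the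
identity on coordinates. [folklore] -/
def cechSectionEquivEdgeCompatible : 𝔚.simplexCover.CechSection φ ≃+ 𝔚.edgeCompatible φ where
  toFun := toEdgeCompatible 𝔚
  invFun := ofEdgeCompatible 𝔚
  left_inv t := by ext a; rfl
  right_inv h := Subtype.ext (funext fun _ => rfl)
  map_add' _ _ := Subtype.ext (funext fun _ => rfl)

/-- Coordinates of `cechSectionEquivEdgeCompatible`. [folklore] -/
@[simp] theorem coe_cechSectionEquivEdgeCompatible_apply (t : 𝔚.simplexCover.CechSection φ)
    (σ : Simplex (Fin (𝔚.r + 1)) 0) :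
    (𝔚.cechSectionEquivEdgeCompatible φ t : ∀ σ : Simplex (Fin (𝔚.r + 1)) 0,
      Γ(X', φ ⁻¹ᵁ 𝔚.opens σ.1)) σ = t.s (ULift.up σ) := rfl

/-- Coordinates of the inverse of `cechSectionEquivEdgeCompatible`. [folklore] -/
@[simp] theorem cechSectionEquivEdgeCompatible_symm_s (h : 𝔚.edgeCompatible φ)
    (σ : 𝔚.simplexCover.κ) :
    ((𝔚.cechSectionEquivEdgeCompatible φ).symm h).s σ = h.1 σ.down := rfl

end Bridge

end CechCover

end CartierDivisor

end Literature.AlgebraicGeometry.Motives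

end
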